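import Mathlib
import Summits.NavierStokesRegularity.NavierStokesRegularity.Theses.CalmSliceGate
import Summits.NavierStokesRegularity.NavierStokesRegularity.Theorems.LerayQuarterDissipationDissipativeZoom
import HarnessLib

/-!
# `CalmSliceGate.DissipativeZoom` (item stmt-NavierStokesRegularity-24377; restated support)

**Statement.** At a singular point of a Type-I blow-up obeying the quarter law, the KNSS zoom yields a
Type-I ancient mild profile with the finite-dissipation law, singular at the apex.

PROOF. Verbatim restatement, inside route `CalmSliceGate`, of the CLOSED item
stmt-NavierStokesRegularity-22146 of route `LerayQuarterDissipation`; closed by the tree theorem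
`lerayQuarterDissipation_dissipativeZoom_proof` (same proposition after unfolding).

HONEST FRAMING: a compactness step about HYPOTHETICAL blow-up solutions, re-used by name; nothing
here bears on Navier–Stokes regularity itself.
-/

noncomputable section

set_option linter.dupNamespace false

namespace Summit.NavierStokesRegularity.NavierStokesRegularity.Theorems

/-- **Item stmt-NavierStokesRegularity-24377** (`CalmSliceGate.DissipativeZoom`): the dissipative
singular Type-I zoom limit — by the tree theorem `lerayQuarterDissipation_dissipativeZoom_proof`
(item stmt-NavierStokesRegularity-22146, the same proposition). [folklore] -/
theorem calmSliceGate_dissipativeZoom_proof :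
    Summit.NavierStokesRegularity.NavierStokesRegularity.Theses.CalmSliceGate.DissipativeZoom := by
  unfold Summit.NavierStokesRegularity.NavierStokesRegularity.Theses.CalmSliceGate.DissipativeZoom
  intro ν T hν hT u p hsol hLH hdec hTI K hK x₀ hx₀
  exact lerayQuarterDissipation_dissipativeZoom_proof ν T hν hT u p hsol hLH hdec hTI K hK x₀ hx₀

end Summit.NavierStokesRegularity.NavierStokesRegularity.Theorems

end
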